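import Summits.CriticalPhenomena.PercolationContinuityZ3.Theorems.PercNearOneGluingNoHeavyPcintMeanMemZ6M10Defs
import HarnessLib

/-!
# PCINT lane, kernel reduced-state B3m certificate `Z6M10` (bond, d = 6, memory τ = 10, kc = 4, 6192 state classes): row checks 3a (rows [2000, 2500))

Cell `prim-pcint`, seat `prim-pcint-2` (gen 4); memo `run/shared/lean/prim/pcint/REDUCTIONS.md` §B3m and HANDOFF ("B3m on reduced states").
Does NOT build on p205010.  Data for `BondK.le_criticalProb_of_checkRowsM` (`…PcintMeanMemKernelCert`): `p = 9310/100000`, chain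
parameter `kc = 4`, `s̄ = 99566/100000` (`s̄²+p² ≥ 1`), `t̄ = 98415/100000` (`(1-p)(1+2p) ≤ t̄(1+p)`, `1-p ≤ s̄ t̄²`, `t̄ ≤ s̄²`), `t̄' = 99208/100000`
(`p² ≤ (t̄'-t̄)(1+p)`), mean corner-third unit `m̄ = 98812/100000 ≥ (t̄+t̄')/2`, `κ̄ = (100000²+99566²)/(2·100000²)`, `λ = 99999/100000`; Collatz–Wielandt
weights (scale 10⁹) from a power iteration (ρ ≈ 0.9996623), exact off-line max row ratio 0.9996623295 < λ.  Generated by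
work/gen/gen_b3m_kernel.py (prim-pcint-2 gen 4 folder; copy in run/shared/lean/prim/pcint/prim-pcint-2/kernel/); the kernel re-checks every row.
-/

namespace Summit.CriticalPhenomena.PercolationContinuityZ3.Theorems.Pcint.MeanMemZ6M10

set_option maxHeartbeats 0 in
/-- Rows `[2000, 2100)` pass the check. [folklore] -/
theorem chk_2000 : WinK.allRange (BondK.checkRowM 10 4 6 6192 9310 99566 98415 98812 100000 99999 100000 MeanMemZ6M10.syms MeanMemZ6M10.tree) 2000 2100 = true :=
  WinK.allRange_of_allRangeB (fuel := 8) (lo := 2000) (len := 100) (by decide +kernel)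

set_option maxHeartbeats 0 in
/-- Rows `[2100, 2200)` pass the check. [folklore] -/
theorem chk_2100 : WinK.allRange (BondK.checkRowM 10 4 6 6192 9310 99566 98415 98812 100000 99999 100000 MeanMemZ6M10.syms MeanMemZ6M10.tree) 2100 2200 = true :=
  WinK.allRange_of_allRangeB (fuel := 8) (lo := 2100) (len := 100) (by decide +kernel)

set_option maxHeartbeats 0 in
/-- Rows `[2200, 2300)` pass the check. [folklore] -/
theorem chk_2200 : WinK.allRange (BondK.checkRowM 10 4 6 6192 9310 99566 98415 98812 100000 99999 100000 MeanMemZ6M10.syms MeanMemZ6M10.tree) 2200 2300 = true :=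
  WinK.allRange_of_allRangeB (fuel := 8) (lo := 2200) (len := 100) (by decide +kernel)

set_option maxHeartbeats 0 in
/-- Rows `[2300, 2400)` pass the check. [folklore] -/
theorem chk_2300 : WinK.allRange (BondK.checkRowM 10 4 6 6192 9310 99566 98415 98812 100000 99999 100000 MeanMemZ6M10.syms MeanMemZ6M10.tree) 2300 2400 = true :=
  WinK.allRange_of_allRangeB (fuel := 8) (lo := 2300) (len := 100) (by decide +kernel)

set_option maxHeartbeats 0 in
/-- Rows `[2400, 2500)` pass the check. [folklore] -/
theorem chk_2400 : WinK.allRange (BondK.checkRowM 10 4 6 6192 9310 99566 98415 98812 100000 99999 100000 MeanMemZ6M10.syms MeanMemZ6M10.tree) 2400 2500 = true :=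
  WinK.allRange_of_allRangeB (fuel := 8) (lo := 2400) (len := 100) (by decide +kernel)

/-- Rows `[2000, 2500)` pass the check. [folklore] -/
theorem file_3a : WinK.allRange (BondK.checkRowM 10 4 6 6192 9310 99566 98415 98812 100000 99999 100000 MeanMemZ6M10.syms MeanMemZ6M10.tree) 2000 2500 = true := (WinK.allRange_split (WinK.allRange_split (WinK.allRange_split (WinK.allRange_split chk_2000 chk_2100) chk_2200) chk_2300) chk_2400)

end Summit.CriticalPhenomena.PercolationContinuityZ3.Theorems.Pcint.MeanMemZ6M10
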